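import Mathlib
import Literature.RingTheory.MvPowerSeries.PartialDerivative
import Literature.AlgebraicGeometry.Resolution.CobordantChartCoefficients
import Literature.AlgebraicGeometry.Resolution.FormalCoordinateChange
import Literature.AlgebraicGeometry.Resolution.FormalInverseFunction
import Literature.AlgebraicGeometry.Resolution.CobordantVertexChart

/-!
# The arc lemma for cobordant blow-ups, and a germ no single weighted move resolves

Folklore, proved (cdisprove refuter for the crux `LocalWeightedDrop`,
stmt-ResolutionOfSingularities-8899, route ResolutionOfSingularities/WeightedInvariant).

ARC LEMMA (`exists_offVertex_singular_of_arc`): let `f'` be a formal germ, `w` weights, and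
`Γ(t)` an arc through the origin NOT contained in the centre `V(xᵢ : wᵢ > 0)` along which `f'`
and all its partial derivatives (`Literature.RingTheory.MvPowerSeries.pd`) vanish — an arc of
the singular locus.  Then some exceptional point `c` of Włodarczyk's cobordant blow-up lies OFF
THE VERTEX (crux convention `cᵢ = 0` for `wᵢ = 0`) and EVERY factorisation
`f'(s^w(c+y)) = sᵃ·g` has `g` SINGULAR there.  Ingredients: the chart-level statement
`singular_of_arc` (Leibniz + chain rule), the ramified LIFT of the arc `exists_arc_lift`
(`t ↦ t^W`, `s = t^ν`, `PowerSeries.expand`), and transport through the chart (`pd_subst`).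

APPLICATION (`witness_has_singular_successor`): over EVERY field, from the germ
`witness = x² + y³z²` (order 2, singular along the two lines `x=y=0`, `x=z=0`) EVERY legal move
`(θ, w)` of the crux (`θ` zero constants with invertible linear part, some `wᵢ > 0`) has an
exceptional point off the vertex whose `s`-saturated successor is SINGULAR — in the literal
chart/guard form of `LocalWeightedDrop`.  Centres of codimension `≥ 2`: transport the coordinate
arcs through `θ` by the formal inverse function theorem (`FormalCoordChange.exists_comp_inverse`),
one of them leaves the centre (`exists_coordArc_not_in_centre`, a `3 × 3` determinant), then
the arc lemma.  Divisorial centres: `s ∣ f'(chart)` iff `x_{i₀} ∣ f'`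
(`X_dvd_subst_chart_divisorial_iff`) and `x_{i₀} ∤ (x²+y³z²)(θ)` by an order computation
(`not_X_dvd_subst_witness`).  Consequence recorded in the disprover's file: the natural
strengthening "the rank function is the multiplicity" of `LocalWeightedDrop` is FALSE.
-/

namespace Literature.AlgebraicGeometry.Resolution.CobordantArc

open MvPowerSeries Literature.RingTheory.MvPowerSeries

/-! ### C0: the chart-level arc lemma -/

section ArcLemma

variable {k : Type*} [Field k] {n : ℕ}

/-- Substituting a zero-constant arc does not change the constant coefficient. [folklore] -/
theorem constantCoeff_subst_arc (Λ : Fin (n + 1) → PowerSeries k)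
    (hΛ : ∀ J, MvPowerSeries.constantCoeff (Λ J) = 0) (g : MvPowerSeries (Fin (n + 1)) k) :
    PowerSeries.constantCoeff (MvPowerSeries.subst Λ g) = MvPowerSeries.constantCoeff g := by
  have has := MvPowerSeries.hasSubst_of_constantCoeff_zero hΛ
  change MvPowerSeries.constantCoeff (MvPowerSeries.subst Λ g) = _
  rw [← MvPowerSeries.coeff_zero_eq_constantCoeff_apply, MvPowerSeries.coeff_subst has,
    finsum_eq_single _ 0]
  · simp
  · intro d hd
    have h1 : (1 : ℕ∞) ≤ MvPowerSeries.order (d.prod fun i m => Λ i ^ m) := by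
      refine le_trans ?_ (degree_le_order_finsuppProd hΛ d)
      have : d.degree ≠ 0 := fun h0 => hd ((Finsupp.degree_eq_zero_iff d).mp h0)
      exact_mod_cast Nat.one_le_iff_ne_zero.mpr this
    rw [MvPowerSeries.coeff_of_lt_order (lt_of_lt_of_le (by rw [map_zero, Nat.cast_zero]; exact zero_lt_one) h1),
      smul_zero]

/-- `∂_J (sᵃ)`: `a · s^{a-1}` for `J = 0`, else `0` (stated multiplicatively to avoid `a - 1`). [folklore] -/
theorem pd_X_zero_pow (J : Fin (n + 1)) (a : ℕ) :
    pd J (MvPowerSeries.X (0 : Fin (n + 1)) ^ a : MvPowerSeries (Fin (n + 1)) k) * MvPowerSeries.X 0 =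
      (a : MvPowerSeries (Fin (n + 1)) k) * MvPowerSeries.X 0 ^ a * (if (0 : Fin (n + 1)) = J then 1 else 0) := by
  classical
  cases a with
  | zero => simp [pd_one]
  | succ a =>
    rw [pd_pow_succ, pd_X]
    push_cast
    ring

/-- CHART-LEVEL ARC LEMMA.  If an arc `Λ(t) = (s(t), y(t))` with `s ≠ 0`, `Λ(0) = 0`, kills `F`
and all its partial derivatives, and `F = sᵃ · g`, then `g` is SINGULAR at the origin
(`g(0) = 0` and `g` has no linear terms). [folklore] -/
theorem singular_of_arc {F g : MvPowerSeries (Fin (n + 1)) k} {a : ℕ}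
    (hfac : F = MvPowerSeries.X 0 ^ a * g) (Λ : Fin (n + 1) → PowerSeries k)
    (hΛ : ∀ J, MvPowerSeries.constantCoeff (Λ J) = 0) (hs : Λ 0 ≠ 0)
    (h0 : MvPowerSeries.subst Λ F = 0) (h1 : ∀ J, MvPowerSeries.subst Λ (pd J F) = 0) :
    MvPowerSeries.constantCoeff g = 0 ∧ ∀ J, MvPowerSeries.coeff (Finsupp.single J 1) g = 0 := by
  classical
  have has := MvPowerSeries.hasSubst_of_constantCoeff_zero hΛ
  have hsa : (Λ 0) ^ a ≠ 0 := pow_ne_zero _ hs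
  -- `g(Λ) = 0`
  have hg : MvPowerSeries.subst Λ g = 0 := by
    rw [hfac, MvPowerSeries.subst_mul has, MvPowerSeries.subst_pow has, MvPowerSeries.subst_X has] at h0
    rcases mul_eq_zero.mp h0 with h | h
    · exact absurd h hsa
    · exact h
  refine ⟨by rw [← constantCoeff_subst_arc Λ hΛ g, hg, map_zero], fun J => ?_⟩
  -- `∂_J g (Λ) = 0`
  have hpdg : MvPowerSeries.subst Λ (pd J g) = 0 := by
    have hJ := h1 J
    rw [hfac, pd_mul] at hJ
    -- multiply the identity by `s(t)` to use `pd_X_zero_pow`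
    have hJ' : MvPowerSeries.subst Λ ((pd J (MvPowerSeries.X 0 ^ a) * MvPowerSeries.X 0) * g +
        MvPowerSeries.X 0 ^ (a + 1) * pd J g) = 0 := by
      have : (pd J (MvPowerSeries.X 0 ^ a) * MvPowerSeries.X 0) * g + MvPowerSeries.X 0 ^ (a + 1) * pd J g =
          MvPowerSeries.X 0 * (pd J (MvPowerSeries.X 0 ^ a) * g + MvPowerSeries.X 0 ^ a * pd J g) := by ring
      rw [this, MvPowerSeries.subst_mul has, hJ, mul_zero]
    rw [pd_X_zero_pow] at hJ'
    rw [MvPowerSeries.subst_add has, MvPowerSeries.subst_mul has, MvPowerSeries.subst_mul has,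
      hg, mul_zero, zero_add] at hJ'
    rw [MvPowerSeries.subst_mul has, MvPowerSeries.subst_pow has, MvPowerSeries.subst_X has] at hJ'
    rcases mul_eq_zero.mp hJ' with h | h
    · exact absurd h (pow_ne_zero _ hs)
    · exact h
  have := constantCoeff_subst_arc Λ hΛ (pd J g)
  rw [hpdg, map_zero, ← MvPowerSeries.coeff_zero_eq_constantCoeff_apply, coeff_pd] at this
  simpa using this.symm

end ArcLemma


/-! ### C1: lifting an arc to the cobordant chart; D: transport -/

section ArcLift

open Literature.AlgebraicGeometry.Resolution.CobordantChart

variable {k : Type*} [Field k] {n : ℕ}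

/-- `constantCoeff_chart` (see the module docstring). [folklore] -/
theorem constantCoeff_chart (w : Fin n → ℕ) (c : Fin n → k) (hc : ∀ i, w i = 0 → c i = 0) (i : Fin n) :
    MvPowerSeries.constantCoeff (chart w c i) = 0 := by
  rw [chart_apply]
  by_cases h : w i = 0
  · simp [h, hc i h, MvPowerSeries.constantCoeff_X]
  · simp [MvPowerSeries.constantCoeff_X, zero_pow h]

/-- Cross-multiplied minimality of a ratio `ν i / w i` over a nonempty finset. [folklore] -/
theorem exists_min_ratio (S : Finset (Fin n)) (hS : S.Nonempty) (ν w : Fin n → ℕ)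
    (hw : ∀ i ∈ S, 0 < w i) :
    ∃ i ∈ S, ∀ j ∈ S, ν i * w j ≤ ν j * w i := by
  obtain ⟨i, hi, hmin⟩ := S.exists_min_image (fun i => (ν i : ℚ) / w i) hS
  refine ⟨i, hi, fun j hj => ?_⟩
  have h := hmin j hj
  rw [div_le_div_iff₀ (by exact_mod_cast hw i hi) (by exact_mod_cast hw j hj)] at h
  exact_mod_cast h

/-- ARC LIFTING.  An arc `Γ` through the origin (zero constant terms) not contained in the
centre `V(xᵢ : wᵢ > 0)` lifts, after the ramified reparametrisation `t ↦ t^W`, to an arc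
`Λ = (s(t), y(t))` of the cobordant chart at an exceptional point `c` OFF THE VERTEX:
`chart_c(Λ(t)) = Γ(t^W)`, with `s ≠ 0` and `Λ(0) = 0`. [folklore] -/
theorem exists_arc_lift (w : Fin n → ℕ) (Γ : Fin n → PowerSeries k)
    (hΓ0 : ∀ i, PowerSeries.constantCoeff (Γ i) = 0) (hS : ∃ i, 0 < w i ∧ Γ i ≠ 0) :
    ∃ (W : ℕ) (hW : W ≠ 0) (c : Fin n → k) (Λ : Fin (n + 1) → PowerSeries k),
      (∀ i, w i = 0 → c i = 0) ∧ (∃ i, 0 < w i ∧ c i ≠ 0) ∧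
      (∀ J, PowerSeries.constantCoeff (Λ J) = 0) ∧ Λ 0 ≠ 0 ∧
      ∀ i, (MvPowerSeries.subst Λ (chart w c i) : PowerSeries k) = PowerSeries.expand W hW (Γ i) := by
  classical
  -- the index achieving the minimal slope ν/w
  let S : Finset (Fin n) := Finset.univ.filter fun i => 0 < w i ∧ Γ i ≠ 0
  have hSne : S.Nonempty := by
    obtain ⟨i, hi, hne⟩ := hS
    exact ⟨i, Finset.mem_filter.mpr ⟨Finset.mem_univ _, hi, hne⟩⟩
  let ν : Fin n → ℕ := fun i => (Γ i).order.toNat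
  obtain ⟨i₀, hi₀S, hmin⟩ := exists_min_ratio S hSne ν w (fun i hi => (Finset.mem_filter.mp hi).2.1)
  obtain ⟨hw₀, hΓ₀⟩ := (Finset.mem_filter.mp hi₀S).2
  set W := w i₀ with hWdef
  have hW : W ≠ 0 := by omega
  set m := ν i₀ with hmdef
  -- `m ≥ 1`
  have hm1 : 1 ≤ m := by
    by_contra hlt
    have hm0 : m = 0 := by omega
    have := PowerSeries.coeff_order hΓ₀
    rw [show (Γ i₀).order.toNat = m from rfl, hm0, PowerSeries.coeff_zero_eq_constantCoeff_apply,
      hΓ0 i₀] at this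
    exact this rfl
  -- expanded arc
  let Γe : Fin n → PowerSeries k := fun i => PowerSeries.expand W hW (Γ i)
  -- low coefficients of `Γe i` vanish below `m * w i`
  have hlow : ∀ i, 0 < w i → ∀ d, d < m * w i → PowerSeries.coeff d (Γe i) = 0 := by
    intro i hwi d hd
    by_cases hzero : Γ i = 0
    · simp [Γe, hzero]
    · have hiS : i ∈ S := Finset.mem_filter.mpr ⟨Finset.mem_univ _, hwi, hzero⟩
      have hle : m * w i ≤ ν i * W := hmin i hiS
      apply PowerSeries.coeff_of_lt_order_toNat
      have hord : (Γe i).order = W • (Γ i).order := PowerSeries.order_expand W hW (Γ i)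
      have hfin : (Γ i).order = (ν i : ℕ∞) := (ENat.coe_toNat ?_).symm
      swap; · exact (PowerSeries.order_finite_iff_ne_zero.mpr hzero).ne
      rw [hord, hfin]
      simp only [nsmul_eq_mul]
      norm_cast
      simp only [ENat.toNat_coe]
      calc d < m * w i := hd
        _ ≤ ν i * W := hle
        _ = W * ν i := mul_comm _ _
  -- the quotients and the lifted arc
  let q : Fin n → PowerSeries k := fun i => PowerSeries.mk fun d => PowerSeries.coeff (d + m * w i) (Γe i)
  have hq : ∀ i, 0 < w i → (PowerSeries.X : PowerSeries k) ^ (m * w i) * q i = Γe i := by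
    intro i hwi
    ext d
    rw [PowerSeries.coeff_X_pow_mul']
    split_ifs with hle
    · simp only [q, PowerSeries.coeff_mk]
      rw [Nat.sub_add_cancel hle]
    · exact (hlow i hwi d (by omega)).symm
  let c : Fin n → k := fun i => if 0 < w i then PowerSeries.coeff (m * w i) (Γe i) else 0
  let Λ : Fin (n + 1) → PowerSeries k :=
    Fin.cons (PowerSeries.X ^ m) fun i => if 0 < w i then q i - PowerSeries.C (c i) else Γe i
  have hΛ0 : Λ 0 = PowerSeries.X ^ m := Fin.cons_zero _ _
  have hΛs : ∀ i, Λ i.succ = if 0 < w i then q i - PowerSeries.C (c i) else Γe i :=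
    fun i => Fin.cons_succ _ _ i
  have hΛc : ∀ J, PowerSeries.constantCoeff (Λ J) = 0 := by
    intro J
    refine Fin.cases ?_ (fun i => ?_) J
    · rw [hΛ0, map_pow, PowerSeries.constantCoeff_X, zero_pow (by omega)]
    · rw [hΛs]
      split_ifs with hwi
      · rw [map_sub, PowerSeries.constantCoeff_C, ← PowerSeries.coeff_zero_eq_constantCoeff_apply]
        simp [q, c, hwi, PowerSeries.coeff_mk]
      · simp only [Γe, PowerSeries.constantCoeff_expand, hΓ0 i]
  refine ⟨W, hW, c, Λ, fun i hi => by simp [c, hi], ⟨i₀, hw₀, ?_⟩, hΛc, ?_, fun i => ?_⟩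
  · -- `c i₀ ≠ 0`: it is the leading coefficient of `Γ i₀`
    simp only [c, Γe]
    rw [if_pos (show 0 < w i₀ from hw₀),
      show m * w i₀ = W * m by rw [hWdef, mul_comm], PowerSeries.coeff_expand_mul]
    exact PowerSeries.coeff_order hΓ₀
  · rw [hΛ0]; exact pow_ne_zero _ PowerSeries.X_ne_zero
  · -- the chart identity
    have has : MvPowerSeries.HasSubst Λ := MvPowerSeries.hasSubst_of_constantCoeff_zero hΛc
    rw [chart_apply, MvPowerSeries.subst_mul has, MvPowerSeries.subst_pow has, MvPowerSeries.subst_X has,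
      MvPowerSeries.subst_add has, MvPowerSeries.subst_X has, MvPowerSeries.subst_C, hΛ0, hΛs]
    by_cases hwi : 0 < w i
    · rw [if_pos hwi]
      have : (MvPowerSeries.C (c i) : MvPowerSeries Unit k) = PowerSeries.C (c i) := rfl
      rw [this, add_sub_cancel, ← pow_mul, hq i hwi]
    · rw [if_neg hwi]
      have h0 : w i = 0 := by omega
      simp [h0, c]
      rfl

end ArcLift


/-! ### D: the arc lemma downstairs -/

section ArcDown

open Literature.AlgebraicGeometry.Resolution.CobordantChart

variable {k : Type*} [Field k] {n : ℕ}

/-- THE ARC LEMMA (in the coordinates of the move).  Let `f'` be a germ, `w` weights, and `Γ` an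
arc through the origin, not contained in the centre `V(xᵢ : wᵢ > 0)`, along which `f'` and all
its partial derivatives vanish (an arc in the singular locus).  Then there is an exceptional point
`c` of the cobordant blow-up OFF THE VERTEX (crux convention) such that for EVERY factorisation
`f'(s^w(c+y)) = sᵃ · g` the `s`-saturated successor candidate `g` is SINGULAR at `c`. [folklore] -/
theorem exists_offVertex_singular_of_arc (w : Fin n → ℕ) (f' : MvPowerSeries (Fin n) k)
    (Γ : Fin n → PowerSeries k) (hΓ0 : ∀ i, PowerSeries.constantCoeff (Γ i) = 0)
    (hS : ∃ i, 0 < w i ∧ Γ i ≠ 0)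
    (hf : (MvPowerSeries.subst Γ f' : PowerSeries k) = 0)
    (hpd : ∀ m, (MvPowerSeries.subst Γ (pd m f') : PowerSeries k) = 0) :
    ∃ c : Fin n → k, (∀ i, w i = 0 → c i = 0) ∧ (∃ i, 0 < w i ∧ c i ≠ 0) ∧
      ∀ (a : ℕ) (g : MvPowerSeries (Fin (n + 1)) k),
        MvPowerSeries.subst (chart w c) f' = MvPowerSeries.X 0 ^ a * g →
        (MvPowerSeries.constantCoeff g = 0 ∧ ∀ J, MvPowerSeries.coeff (Finsupp.single J 1) g = 0) := by
  classical
  obtain ⟨W, hW, c, Λ, hc, hoff, hΛc, hs, hchart⟩ := exists_arc_lift w Γ hΓ0 hS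
  have hasΛ : MvPowerSeries.HasSubst Λ := MvPowerSeries.hasSubst_of_constantCoeff_zero hΛc
  have hasΓ : MvPowerSeries.HasSubst Γ := MvPowerSeries.hasSubst_of_constantCoeff_zero hΓ0
  have hasC : MvPowerSeries.HasSubst (chart w c) := hasSubst_chart w c hc
  -- transport of vanishing along the arc through the chart
  have key : ∀ φ : MvPowerSeries (Fin n) k, (MvPowerSeries.subst Γ φ : PowerSeries k) = 0 →
      (MvPowerSeries.subst Λ (MvPowerSeries.subst (chart w c) φ) : PowerSeries k) = 0 := by
    intro φ hφ
    rw [MvPowerSeries.subst_comp_subst_apply hasC hasΛ]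
    have : (fun i => MvPowerSeries.subst Λ (chart w c i)) =
        fun i => MvPowerSeries.expand W hW (Γ i) := by
      funext i; exact hchart i
    rw [this, ← MvPowerSeries.expand_subst W hW hasΓ]
    change MvPowerSeries.expand W hW (MvPowerSeries.subst Γ φ) = 0
    rw [hφ, map_zero]
  refine ⟨c, hc, hoff, fun a g hfac => ?_⟩
  refine singular_of_arc hfac Λ hΛc hs (key f' hf) fun J => ?_
  rw [pd_subst (chart w c) (constantCoeff_chart w c hc) f' J, ← MvPowerSeries.coe_substAlgHom hasΛ,
    map_sum]
  refine Finset.sum_eq_zero fun m _ => ?_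
  rw [map_mul, MvPowerSeries.coe_substAlgHom hasΛ, key (pd m f') (hpd m), zero_mul]

end ArcDown


/-! ### E0: linear parts under substitution (first-order chain rule) -/

section LinearPart

variable {k : Type*} [Field k] {n : ℕ} {τ : Type*}

/-- FIRST-ORDER CHAIN RULE: the linear coefficients of `subst a φ` (zero-constant `a`) are
`∑ₘ (linear coefficient of φ in xₘ) · (linear coefficient of aₘ)`. [folklore] -/
theorem coeff_degree_one_subst (a : Fin n → MvPowerSeries τ k)
    (ha : ∀ i, MvPowerSeries.constantCoeff (a i) = 0) (φ : MvPowerSeries (Fin n) k)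
    (e : τ →₀ ℕ) (he : e.degree = 1) :
    MvPowerSeries.coeff e (MvPowerSeries.subst a φ) =
      ∑ m, MvPowerSeries.coeff (Finsupp.single m 1) φ * MvPowerSeries.coeff e (a m) := by
  classical
  have has := MvPowerSeries.hasSubst_of_constantCoeff_zero ha
  rw [MvPowerSeries.coeff_subst has]
  -- only the exponents `single m 1` contribute
  rw [finsum_eq_sum_of_support_subset (s := Finset.univ.image fun m : Fin n => Finsupp.single m 1)]
  · rw [Finset.sum_image (fun m _ m' _ h => (Finsupp.single_left_inj one_ne_zero).mp h)]
    refine Finset.sum_congr rfl fun m _ => ?_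
    rw [Finsupp.prod_single_index (h := fun s e => a s ^ e) (pow_zero _), pow_one, smul_eq_mul]
  · intro d hd
    rw [Function.mem_support] at hd
    rw [Finset.coe_image, Finset.coe_univ, Set.image_univ, Set.mem_range]
    -- `degree d ≤ 1` since otherwise the product has order ≥ 2 > degree e; `d ≠ 0` since φ-term...
    by_contra hnot
    apply hd
    by_cases hdeg : 2 ≤ d.degree
    · rw [MvPowerSeries.coeff_of_lt_order (lt_of_lt_of_le (by rw [he]; exact_mod_cast hdeg)
        (degree_le_order_finsuppProd' ha d hdeg)), smul_zero]
    · -- degree d ≤ 1 and d not a `single m 1`: d = 0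
      have hd0 : d = 0 := by
        rcases Literature.AlgebraicGeometry.Resolution.FormalCoordChange.eq_zero_or_single_of_degree_lt_two d
          (by omega) with h | ⟨m, hm⟩
        · exact h
        · exact absurd ⟨m, hm.symm⟩ hnot
      subst hd0
      simp only [Finsupp.prod_zero_index]
      rw [MvPowerSeries.coeff_one, if_neg, smul_zero]
      intro he0; rw [he0] at he; simp at he
where
  /-- order bound (restated for arbitrary `τ`) -/
  degree_le_order_finsuppProd' {a : Fin n → MvPowerSeries τ k}
      (ha : ∀ i, MvPowerSeries.constantCoeff (a i) = 0) (d : Fin n →₀ ℕ) (_hd : 2 ≤ d.degree) :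
      (d.degree : ℕ∞) ≤ (d.prod fun i m => a i ^ m).order := degree_le_order_finsuppProd ha d

/-- Linear part of a composition `X s = θ_s(ψ)`: the linear matrices multiply to `1`. [folklore] -/
theorem linMat_mul_of_comp_eq_X {θ ψ : Fin n → MvPowerSeries (Fin n) k}
    (hψ : ∀ i, MvPowerSeries.constantCoeff (ψ i) = 0)
    (hcomp : ∀ s, MvPowerSeries.subst ψ (θ s) = MvPowerSeries.X s) :
    (Matrix.of fun s m => MvPowerSeries.coeff (Finsupp.single m 1) (θ s)) *
      (Matrix.of fun m j => MvPowerSeries.coeff (Finsupp.single j 1) (ψ m)) = 1 := by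
  classical
  ext s j
  rw [Matrix.mul_apply, Matrix.one_apply]
  have := congrArg (MvPowerSeries.coeff (Finsupp.single j 1)) (hcomp s)
  rw [coeff_degree_one_subst ψ hψ (θ s) _ (Finsupp.degree_single _ _), MvPowerSeries.coeff_X] at this
  simp only [Matrix.of_apply]
  rw [this]
  by_cases hsj : s = j
  · subst hsj; simp
  · have : ¬ (Finsupp.single j 1 : Fin n →₀ ℕ) = Finsupp.single s 1 := fun hh =>
      hsj ((Finsupp.single_left_inj one_ne_zero).mp hh).symm
    simp [hsj, this]

end LinearPart


/-! ### E1: transporting arcs through the prover's coordinate change -/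

section Transport

variable {k : Type*} [Field k] {n : ℕ}

/-- `constantCoeff_subst_arc_zero` (see the module docstring). [folklore] -/
theorem constantCoeff_subst_arc_zero {ψ : Fin n → MvPowerSeries (Fin n) k}
    (hψ0 : ∀ i, MvPowerSeries.constantCoeff (ψ i) = 0) (γ : Fin n → PowerSeries k)
    (hγ0 : ∀ i, PowerSeries.constantCoeff (γ i) = 0) (i : Fin n) :
    PowerSeries.constantCoeff (MvPowerSeries.subst γ (ψ i) : PowerSeries k) = 0 :=
  MvPowerSeries.constantCoeff_subst_eq_zero (MvPowerSeries.hasSubst_of_constantCoeff_zero hγ0) hγ0 (hψ0 i)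

/-- If `θ(ψ) = X` then the arc `Γ = ψ ∘ γ` satisfies `φ(θ)(Γ) = φ(γ)`. [folklore] -/
theorem subst_arc_comp {θ ψ : Fin n → MvPowerSeries (Fin n) k}
    (hθ0 : ∀ i, MvPowerSeries.constantCoeff (θ i) = 0) (hψ0 : ∀ i, MvPowerSeries.constantCoeff (ψ i) = 0)
    (hcomp : ∀ s, MvPowerSeries.subst ψ (θ s) = MvPowerSeries.X s) (γ : Fin n → PowerSeries k)
    (hγ0 : ∀ i, PowerSeries.constantCoeff (γ i) = 0) (φ : MvPowerSeries (Fin n) k) :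
    (MvPowerSeries.subst (fun i => (MvPowerSeries.subst γ (ψ i) : PowerSeries k)) (MvPowerSeries.subst θ φ) :
      PowerSeries k) = MvPowerSeries.subst γ φ := by
  have hasθ := MvPowerSeries.hasSubst_of_constantCoeff_zero hθ0
  have hasψ := MvPowerSeries.hasSubst_of_constantCoeff_zero hψ0
  have hasγ : MvPowerSeries.HasSubst γ := MvPowerSeries.hasSubst_of_constantCoeff_zero hγ0
  have hasΓ : MvPowerSeries.HasSubst (fun i => (MvPowerSeries.subst γ (ψ i) : PowerSeries k)) :=
    MvPowerSeries.hasSubst_of_constantCoeff_zero (constantCoeff_subst_arc_zero hψ0 γ hγ0)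
  rw [MvPowerSeries.subst_comp_subst_apply hasθ hasΓ]
  congr 1
  funext s
  rw [← MvPowerSeries.subst_comp_subst_apply hasψ hasγ, hcomp s, MvPowerSeries.subst_X hasγ]

/-- … and the partial derivatives of `φ(θ)` vanish along `Γ` as soon as those of `φ` vanish along `γ`. [folklore] -/
theorem subst_arc_pd_comp {θ ψ : Fin n → MvPowerSeries (Fin n) k}
    (hθ0 : ∀ i, MvPowerSeries.constantCoeff (θ i) = 0) (hψ0 : ∀ i, MvPowerSeries.constantCoeff (ψ i) = 0)
    (hcomp : ∀ s, MvPowerSeries.subst ψ (θ s) = MvPowerSeries.X s) (γ : Fin n → PowerSeries k)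
    (hγ0 : ∀ i, PowerSeries.constantCoeff (γ i) = 0) (φ : MvPowerSeries (Fin n) k)
    (hpd : ∀ l, (MvPowerSeries.subst γ (pd l φ) : PowerSeries k) = 0) (m : Fin n) :
    (MvPowerSeries.subst (fun i => (MvPowerSeries.subst γ (ψ i) : PowerSeries k))
      (pd m (MvPowerSeries.subst θ φ)) : PowerSeries k) = 0 := by
  classical
  have hasΓ : MvPowerSeries.HasSubst (fun i => (MvPowerSeries.subst γ (ψ i) : PowerSeries k)) :=
    MvPowerSeries.hasSubst_of_constantCoeff_zero (constantCoeff_subst_arc_zero hψ0 γ hγ0)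
  rw [pd_subst θ hθ0 φ m, ← MvPowerSeries.coe_substAlgHom hasΓ, map_sum]
  refine Finset.sum_eq_zero fun l _ => ?_
  rw [map_mul, MvPowerSeries.coe_substAlgHom hasΓ, subst_arc_comp hθ0 hψ0 hcomp γ hγ0, hpd l, zero_mul]

end Transport

/-! ### E2: one of two coordinate arcs survives outside a centre of codimension `≥ 2` (n = 3) -/

section NonContainment

variable {k : Type*} [Field k]

/-- The coordinate arc `t ↦ t·e_a`. [folklore] -/
noncomputable def coordArc (a : Fin 3) : Fin 3 → PowerSeries k := fun i => if i = a then PowerSeries.X else 0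

/-- `constantCoeff_coordArc` (see the module docstring). [folklore] -/
theorem constantCoeff_coordArc (a i : Fin 3) : PowerSeries.constantCoeff (coordArc (k := k) a i) = 0 := by
  simp only [coordArc]; split_ifs <;> simp [PowerSeries.constantCoeff_X]

/-- The linear coefficient of `ψᵢ` along the arc `t e_a` is the `(i,a)` entry of the linear
part of `ψ`. [folklore] -/
theorem coeff_one_subst_coordArc (ψ : Fin 3 → MvPowerSeries (Fin 3) k) (a i : Fin 3) :
    PowerSeries.coeff 1 (MvPowerSeries.subst (coordArc (k := k) a) (ψ i) : PowerSeries k) =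
      MvPowerSeries.coeff (Finsupp.single a 1) (ψ i) := by
  classical
  change MvPowerSeries.coeff (Finsupp.single () 1) _ = _
  rw [coeff_degree_one_subst (coordArc a) (constantCoeff_coordArc a) (ψ i) _ (Finsupp.degree_single _ _)]
  rw [Finset.sum_eq_single a]
  · simp only [coordArc, if_true]
    change _ * PowerSeries.coeff 1 PowerSeries.X = _
    rw [PowerSeries.coeff_one_X, mul_one]
  · intro m _ hma
    simp only [coordArc, if_neg hma, map_zero, mul_zero]
  · simp

/-- NON-CONTAINMENT.  If `θ(ψ) = X` (so the linear part of `ψ` is invertible) and at most one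
weight vanishes (`n = 3`, centre of codimension `≥ 2`), then one of the two transported coordinate
arcs `ψ ∘ (t e₁)`, `ψ ∘ (t e₂)` has a non-zero component of positive weight. [folklore] -/
theorem exists_coordArc_not_in_centre {θ ψ : Fin 3 → MvPowerSeries (Fin 3) k}
    (hψ0 : ∀ i, MvPowerSeries.constantCoeff (ψ i) = 0)
    (hcomp : ∀ s, MvPowerSeries.subst ψ (θ s) = MvPowerSeries.X s)
    (w : Fin 3 → ℕ) (j₀ : Fin 3) (hI : ∀ i, i ≠ j₀ → 0 < w i) :
    ∃ a : Fin 3, (a = 1 ∨ a = 2) ∧ ∃ i, 0 < w i ∧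
      (MvPowerSeries.subst (coordArc (k := k) a) (ψ i) : PowerSeries k) ≠ 0 := by
  classical
  by_contra hcon
  push Not at hcon
  -- all entries `Lψ i 1`, `Lψ i 2` with `i ≠ j₀` vanish
  set L : Matrix (Fin 3) (Fin 3) k := Matrix.of fun m j => MvPowerSeries.coeff (Finsupp.single j 1) (ψ m)
  have hz : ∀ i, i ≠ j₀ → L i 1 = 0 ∧ L i 2 = 0 := by
    intro i hi
    constructor
    · have := hcon 1 (Or.inl rfl) i (hI i hi)
      have h := congrArg (PowerSeries.coeff 1) this
      rw [coeff_one_subst_coordArc ψ 1 i, map_zero] at h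
      exact h
    · have := hcon 2 (Or.inr rfl) i (hI i hi)
      have h := congrArg (PowerSeries.coeff 1) this
      rw [coeff_one_subst_coordArc ψ 2 i, map_zero] at h
      exact h
  -- a non-zero kernel vector supported on the coordinates 1, 2
  obtain ⟨v, hv0, hv⟩ : ∃ v : Fin 3 → k, v ≠ 0 ∧ L.mulVec v = 0 := by
    by_cases hdeg : L j₀ 1 = 0 ∧ L j₀ 2 = 0
    · refine ⟨Pi.single 1 1, by simp, ?_⟩
      ext i
      rw [Matrix.mulVec, dotProduct]  -- (L i) ⬝ v
      simp only [Pi.single_apply, mul_ite, mul_one, mul_zero, Finset.sum_ite_eq', Finset.mem_univ,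
        if_true, Pi.zero_apply]
      by_cases hi : i = j₀
      · subst hi; exact hdeg.1
      · exact (hz i hi).1
    · refine ⟨fun j => if j = 1 then L j₀ 2 else if j = 2 then -L j₀ 1 else 0, ?_, ?_⟩
      · intro hv
        apply hdeg
        have h1 := congrFun hv 1
        have h2 := congrFun hv 2
        simp at h1 h2
        exact ⟨by simpa using h2, h1⟩
      · ext i
        simp only [Matrix.mulVec, dotProduct, Fin.sum_univ_three, Pi.zero_apply]
        simp only [Fin.isValue, show (0 : Fin 3) = 1 ↔ False by decide, show (0 : Fin 3) = 2 ↔ False by decide,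
          show (2 : Fin 3) = 1 ↔ False by decide, if_true, if_false, mul_zero, zero_add]
        by_cases hi : i = j₀
        · subst hi; ring
        · rw [(hz i hi).1, (hz i hi).2]; ring
  -- contradiction with invertibility of `L`
  have hmul := linMat_mul_of_comp_eq_X hψ0 hcomp
  have hdet : L.det ≠ 0 := by
    intro h0
    have := congrArg Matrix.det hmul
    rw [Matrix.det_mul, Matrix.det_one] at this
    change _ * L.det = 1 at this
    rw [h0, mul_zero] at this
    exact zero_ne_one this
  exact hdet ((Matrix.exists_mulVec_eq_zero_iff).mp ⟨v, hv0, hv⟩)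

end NonContainment


/-! ### E3: divisorial moves -/

section Divisorial

open Literature.AlgebraicGeometry.Resolution.CobordantChart
  Literature.AlgebraicGeometry.Resolution.FormalCoordChange

variable {k : Type*} [Field k] {n : ℕ}

/-- For a divisorial move (only `w i₀ > 0`) at the point `c = e_{i₀}`, the coefficient of
`s⁰ y^β` of the transform is `φ_β` if `β i₀ = 0` and `0` otherwise. [folklore] -/
theorem coeff_cons_zero_subst_chart_divisorial (w : Fin n → ℕ) (i₀ : Fin n) (hw : 0 < w i₀)
    (hI : ∀ i, i ≠ i₀ → w i = 0) (φ : MvPowerSeries (Fin n) k) (β : Fin n →₀ ℕ) :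
    MvPowerSeries.coeff (Finsupp.cons 0 β) (MvPowerSeries.subst (chart w (Pi.single i₀ (1 : k))) φ) =
      if β i₀ = 0 then MvPowerSeries.coeff β φ else 0 := by
  classical
  have hc : ∀ i, w i = 0 → (Pi.single i₀ (1 : k) : Fin n → k) i = 0 := by
    intro i hi
    have : i ≠ i₀ := fun h => by subst h; omega
    simp [this]
  rw [coeff_subst_chart w _ hc]
  -- weight zero ⟺ `d i₀ = 0`
  have hwt : ∀ d : Fin n →₀ ℕ, Finsupp.weight w d = 0 ↔ d i₀ = 0 := by
    intro d
    rw [Finsupp.weight_apply, Finsupp.sum_fintype _ _ (fun i => by simp)]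
    constructor
    · intro h
      have := (Finset.sum_eq_zero_iff.mp h) i₀ (Finset.mem_univ _)
      simp only [smul_eq_mul, mul_eq_zero] at this
      omega
    · intro h
      apply Finset.sum_eq_zero
      intro i _
      by_cases hi : i = i₀
      · subst hi; simp [h]
      · simp [hI i hi]
  -- the product factor
  have hfac : ∀ d : Fin n →₀ ℕ, d i₀ = 0 →
      (∏ i, (((d i).choose (β i) : k) * (Pi.single i₀ (1 : k) : Fin n → k) i ^ (d i - β i))) =
        if d = β then 1 else 0 := by
    intro d hd0
    split_ifs with hdb
    · subst hdb
      refine Finset.prod_eq_one fun i _ => ?_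
      simp
    · -- some index differs
      obtain ⟨i, hi⟩ : ∃ i, d i ≠ β i := by
        by_contra hcon; push Not at hcon; exact hdb (Finsupp.ext hcon)
      apply Finset.prod_eq_zero (Finset.mem_univ i)
      by_cases hii : i = i₀
      · subst hii
        rw [hd0] at hi ⊢
        rw [Nat.choose_eq_zero_of_lt (by omega), Nat.cast_zero, zero_mul]
      · rcases lt_or_gt_of_ne hi with hlt | hgt
        · rw [Nat.choose_eq_zero_of_lt hlt, Nat.cast_zero, zero_mul]
        · simp [hii, zero_pow (by omega : d i - β i ≠ 0)]
  by_cases hβ : β i₀ = 0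
  · rw [if_pos hβ, finsum_eq_single _ β]
    · rw [if_pos ((hwt β).mpr hβ), hfac β hβ, if_pos rfl, mul_one]
    · intro d hd
      split_ifs with hwd
      · rw [hfac d ((hwt d).mp hwd), if_neg hd, mul_zero]
      · rfl
  · rw [if_neg hβ]
    apply finsum_eq_zero_of_forall_eq_zero
    intro d
    split_ifs with hwd
    · have hd0 := (hwt d).mp hwd
      have hne : d ≠ β := fun h => hβ (h ▸ hd0)
      rw [hfac d hd0, if_neg hne, mul_zero]
    · rfl

/-- DIVISIBILITY TRANSFER for divisorial moves: `s ∣ φ(s^w(e_{i₀} + y))` iff `x_{i₀} ∣ φ`. [folklore] -/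
theorem X_dvd_subst_chart_divisorial_iff (w : Fin n → ℕ) (i₀ : Fin n) (hw : 0 < w i₀)
    (hI : ∀ i, i ≠ i₀ → w i = 0) (φ : MvPowerSeries (Fin n) k) :
    MvPowerSeries.X 0 ∣ MvPowerSeries.subst (chart w (Pi.single i₀ (1 : k))) φ ↔ MvPowerSeries.X i₀ ∣ φ := by
  classical
  constructor
  · intro h
    rw [MvPowerSeries.X_dvd_iff] at h ⊢
    intro β hβ
    have := h (Finsupp.cons 0 β) (Finsupp.cons_zero _ _)
    rwa [coeff_cons_zero_subst_chart_divisorial w i₀ hw hI, if_pos hβ] at this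
  · intro h
    rw [MvPowerSeries.X_dvd_iff] at h ⊢
    intro m hm0
    have hm : m = Finsupp.cons 0 (Finsupp.tail m) := by
      rw [← Finsupp.cons_tail m, hm0]; simp
    rw [hm, coeff_cons_zero_subst_chart_divisorial w i₀ hw hI]
    split_ifs with hβ
    · exact h _ hβ
    · rfl

/-- The witness germ `x² + y³z²`. [folklore] -/
noncomputable def witness (k : Type*) [Field k] : MvPowerSeries (Fin 3) k :=
  MvPowerSeries.X 0 ^ 2 + MvPowerSeries.X 1 ^ 3 * MvPowerSeries.X 2 ^ 2

/-- Killing the coordinate `x_{i₀}`. [folklore] -/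
noncomputable def kill (i₀ : Fin 3) : Fin 3 → MvPowerSeries (Fin 3) k :=
  fun m => if m = i₀ then 0 else MvPowerSeries.X m

/-- `constantCoeff_kill` (see the module docstring). [folklore] -/
theorem constantCoeff_kill (i₀ m : Fin 3) : MvPowerSeries.constantCoeff (kill (k := k) i₀ m) = 0 := by
  simp only [kill]; split_ifs <;> simp [MvPowerSeries.constantCoeff_X]

/-- Linear coefficients after killing `x_{i₀}`: the row of the linear part with column `i₀` deleted. [folklore] -/
theorem coeff_single_subst_kill (θ : Fin 3 → MvPowerSeries (Fin 3) k) (i₀ s j : Fin 3) :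
    MvPowerSeries.coeff (Finsupp.single j 1) (MvPowerSeries.subst (kill (k := k) i₀) (θ s)) =
      if j = i₀ then 0 else MvPowerSeries.coeff (Finsupp.single j 1) (θ s) := by
  classical
  rw [coeff_degree_one_subst (kill i₀) (constantCoeff_kill i₀) (θ s) _ (Finsupp.degree_single _ _)]
  split_ifs with hj
  · subst hj
    apply Finset.sum_eq_zero
    intro m _
    simp only [kill]
    split_ifs with hm
    · simp
    · rw [MvPowerSeries.coeff_X, if_neg, mul_zero]
      intro h; exact hm ((Finsupp.single_left_inj one_ne_zero).mp h).symm
  · rw [Finset.sum_eq_single j]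
    · simp only [kill, if_neg hj]
      rw [MvPowerSeries.coeff_X, if_pos rfl, mul_one]
    · intro m _ hmj
      simp only [kill]
      split_ifs with hm
      · simp
      · rw [MvPowerSeries.coeff_X, if_neg, mul_zero]
        intro h; exact hmj ((Finsupp.single_left_inj one_ne_zero).mp h).symm
    · simp

/-- Two rows of an invertible `3 × 3` matrix cannot both be multiples of the same `e_{i₀}ᵀ`. [folklore] -/
theorem not_two_rows_supported_single {L : Matrix (Fin 3) (Fin 3) k} (hdet : IsUnit L.det)
    (i₀ s s' : Fin 3) (hss : s ≠ s') (hs : ∀ j, j ≠ i₀ → L s j = 0) (hs' : ∀ j, j ≠ i₀ → L s' j = 0) :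
    False := by
  classical
  apply hdet.ne_zero
  by_cases hz : L s i₀ = 0
  · exact Matrix.det_eq_zero_of_row_eq_zero s fun j => by
      by_cases hj : j = i₀
      · subst hj; exact hz
      · exact hs j hj
  · rw [← Matrix.exists_vecMul_eq_zero_iff]
    refine ⟨L s' i₀ • Pi.single s 1 - L s i₀ • Pi.single s' 1, ?_, ?_⟩
    · intro hv
      have := congrFun hv s'
      simp [hss.symm] at this
      exact hz this
    · rw [Matrix.sub_vecMul, Matrix.smul_vecMul, Matrix.smul_vecMul, Matrix.single_one_vecMul,
        Matrix.single_one_vecMul]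
      ext j
      simp only [Pi.sub_apply, Pi.smul_apply, smul_eq_mul, Pi.zero_apply, Matrix.row_apply]
      by_cases hj : j = i₀
      · subst hj; ring
      · rw [hs j hj, hs' j hj]; ring

/-- For the witness `x² + y³z²` and ANY legal `θ`, `x_{i₀} ∤ (x²+y³z²)(θ)`: the transformed
germ is never divisible by a coordinate. [folklore] -/
theorem not_X_dvd_subst_witness {θ : Fin 3 → MvPowerSeries (Fin 3) k}
    (hθ0 : ∀ i, MvPowerSeries.constantCoeff (θ i) = 0)
    (hdet : IsUnit (Matrix.det (Matrix.of fun i j => MvPowerSeries.coeff (Finsupp.single j 1) (θ i))))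
    (i₀ : Fin 3) : ¬ MvPowerSeries.X i₀ ∣ MvPowerSeries.subst θ (witness k) := by
  classical
  rintro ⟨h, hh⟩
  have hasθ := MvPowerSeries.hasSubst_of_constantCoeff_zero hθ0
  have hasκ : MvPowerSeries.HasSubst (kill (k := k) i₀) :=
    MvPowerSeries.hasSubst_of_constantCoeff_zero (constantCoeff_kill i₀)
  set ρ : Fin 3 → MvPowerSeries (Fin 3) k := fun s => MvPowerSeries.subst (kill i₀) (θ s) with hρ
  have hasρ : MvPowerSeries.HasSubst ρ := MvPowerSeries.hasSubst_of_constantCoeff_zero fun s =>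
    MvPowerSeries.constantCoeff_subst_eq_zero hasκ (constantCoeff_kill i₀) (hθ0 s)
  -- the relation `ρ₀² + ρ₁³ρ₂² = 0`
  have hrel : ρ 0 ^ 2 + ρ 1 ^ 3 * ρ 2 ^ 2 = 0 := by
    have h1 : MvPowerSeries.subst (kill (k := k) i₀) (MvPowerSeries.subst θ (witness k)) = 0 := by
      rw [hh, MvPowerSeries.subst_mul hasκ, MvPowerSeries.subst_X hasκ]
      simp [kill]
    rw [MvPowerSeries.subst_comp_subst_apply hasθ hasκ, witness, MvPowerSeries.subst_add hasρ,
      MvPowerSeries.subst_mul hasρ, MvPowerSeries.subst_pow hasρ, MvPowerSeries.subst_pow hasρ,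
      MvPowerSeries.subst_pow hasρ, MvPowerSeries.subst_X hasρ, MvPowerSeries.subst_X hasρ,
      MvPowerSeries.subst_X hasρ] at h1
    exact h1
  -- exceptional rows: those whose linear part vanishes off column i₀
  set L : Matrix (Fin 3) (Fin 3) k := Matrix.of fun i j => MvPowerSeries.coeff (Finsupp.single j 1) (θ i)
  have hexc : ∀ s, 2 ≤ (ρ s).order ↔ ∀ j, j ≠ i₀ → L s j = 0 := by
    intro s
    rw [two_le_order_iff]
    constructor
    · rintro ⟨-, hl⟩ j hj
      have := hl j
      rw [hρ] at this
      simp only at this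
      rw [coeff_single_subst_kill θ i₀ s j, if_neg hj] at this
      exact this
    · intro hz
      refine ⟨MvPowerSeries.constantCoeff_subst_eq_zero hasκ (constantCoeff_kill i₀) (hθ0 s), fun j => ?_⟩
      show MvPowerSeries.coeff (Finsupp.single j 1) (MvPowerSeries.subst (kill i₀) (θ s)) = 0
      rw [coeff_single_subst_kill θ i₀ s j]
      split_ifs with hj
      · rfl
      · exact hz j hj
  have hone : ∀ s, 1 ≤ (ρ s).order := fun s =>
    MvPowerSeries.one_le_order_iff_constCoeff_eq_zero.mpr
      (MvPowerSeries.constantCoeff_subst_eq_zero hasκ (constantCoeff_kill i₀) (hθ0 s))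
  have hatmost : ∀ s s', s ≠ s' → 2 ≤ (ρ s).order → 2 ≤ (ρ s').order → False := fun s s' hss hs hs' =>
    not_two_rows_supported_single hdet i₀ s s' hss ((hexc s).mp hs) ((hexc s').mp hs')
  -- all three `ρ s` are non-zero
  have hρ0 : ∀ s, ρ s = 0 → 2 ≤ (ρ s).order := fun s h => by rw [h, MvPowerSeries.order_zero]; exact le_top
  have hne1 : ρ 1 ≠ 0 := by
    intro h1
    have : ρ 0 ^ 2 = 0 := by rw [h1] at hrel; simpa using hrel
    exact hatmost 0 1 (by decide) (hρ0 0 (pow_eq_zero_iff two_ne_zero |>.mp this)) (hρ0 1 h1)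
  have hne2 : ρ 2 ≠ 0 := by
    intro h2
    have : ρ 0 ^ 2 = 0 := by rw [h2] at hrel; simpa using hrel
    exact hatmost 0 2 (by decide) (hρ0 0 (pow_eq_zero_iff two_ne_zero |>.mp this)) (hρ0 2 h2)
  have hne0 : ρ 0 ≠ 0 := by
    intro h0
    have : ρ 1 ^ 3 * ρ 2 ^ 2 = 0 := by rw [h0] at hrel; simpa using hrel
    rcases mul_eq_zero.mp this with h | h
    · exact hne1 (pow_eq_zero_iff (by norm_num) |>.mp h)
    · exact hne2 (pow_eq_zero_iff two_ne_zero |>.mp h)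
  -- finite orders
  obtain ⟨n0, hn0⟩ : ∃ m : ℕ, (ρ 0).order = m := ENat.ne_top_iff_exists.mp
    (MvPowerSeries.order_eq_top_iff.not.mpr hne0) |>.imp fun _ h => h.symm
  obtain ⟨n1, hn1⟩ : ∃ m : ℕ, (ρ 1).order = m := ENat.ne_top_iff_exists.mp
    (MvPowerSeries.order_eq_top_iff.not.mpr hne1) |>.imp fun _ h => h.symm
  obtain ⟨n2, hn2⟩ : ∃ m : ℕ, (ρ 2).order = m := ENat.ne_top_iff_exists.mp
    (MvPowerSeries.order_eq_top_iff.not.mpr hne2) |>.imp fun _ h => h.symm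
  -- the order equation `2 n0 = 3 n1 + 2 n2`
  have heq : 2 * n0 = 3 * n1 + 2 * n2 := by
    have h := congrArg MvPowerSeries.order (eq_neg_of_add_eq_zero_left hrel)
    rw [MvPowerSeries.order_neg, pow_two, pow_succ, pow_two, pow_two, MvPowerSeries.order_mul,
      MvPowerSeries.order_mul, MvPowerSeries.order_mul, MvPowerSeries.order_mul,
      MvPowerSeries.order_mul, hn0, hn1, hn2] at h
    have h' : ((n0 + n0 : ℕ) : ℕ∞) = ((n1 + n1 + n1 + (n2 + n2) : ℕ) : ℕ∞) := by push_cast; exact h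
    have := ENat.coe_inj.mp h'
    omega
  have h1' : 1 ≤ n0 ∧ 1 ≤ n1 ∧ 1 ≤ n2 := by
    refine ⟨?_, ?_, ?_⟩
    · have := hone 0; rw [hn0] at this; exact_mod_cast this
    · have := hone 1; rw [hn1] at this; exact_mod_cast this
    · have := hone 2; rw [hn2] at this; exact_mod_cast this
  have htwo : ∀ s s' (ms ms' : ℕ), s ≠ s' → (ρ s).order = ms → (ρ s').order = ms' → 2 ≤ ms → 2 ≤ ms' → False := by
    intro s s' ms ms' hss hs hs' h2 h2'
    exact hatmost s s' hss (by rw [hs]; exact_mod_cast h2) (by rw [hs']; exact_mod_cast h2')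
  -- case analysis
  rcases Nat.lt_or_ge n0 2 with h0 | h0
  · omega
  · -- n0 ≥ 2: rows 1, 2 must have order 1
    have : n1 < 2 := by by_contra hh; exact htwo 0 1 n0 n1 (by decide) hn0 hn1 h0 (by omega)
    have : n2 < 2 := by by_contra hh; exact htwo 0 2 n0 n2 (by decide) hn0 hn2 h0 (by omega)
    omega

end Divisorial


/-! ### E4: the witness and the assembly -/

section Assembly

open Literature.AlgebraicGeometry.Resolution.CobordantChart
  Literature.AlgebraicGeometry.Resolution.FormalCoordChange
  Literature.AlgebraicGeometry.Resolution

variable {k : Type*} [Field k]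

/-- `pd_sq` (see the module docstring). [folklore] -/
theorem pd_sq {σ : Type*} [Fintype σ] [DecidableEq σ] (i : σ) (f : MvPowerSeries σ k) :
    pd i (f ^ 2) = 2 * f * pd i f := by
  rw [show (2 : ℕ) = 1 + 1 from rfl, pd_pow_succ]; norm_num

/-- `pd_cube` (see the module docstring). [folklore] -/
theorem pd_cube {σ : Type*} [Fintype σ] [DecidableEq σ] (i : σ) (f : MvPowerSeries σ k) :
    pd i (f ^ 3) = 3 * f ^ 2 * pd i f := by
  rw [show (3 : ℕ) = 2 + 1 from rfl, pd_pow_succ]; norm_num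

/-- Along an arc with `γ₀ = 0` and (`γ₁ = 0` or `γ₂ = 0`) the witness and all its partials vanish. [folklore] -/
theorem subst_arc_witness_eq_zero (γ : Fin 3 → PowerSeries k)
    (hγc : ∀ i, PowerSeries.constantCoeff (γ i) = 0) (h0 : γ 0 = 0) (h12 : γ 1 = 0 ∨ γ 2 = 0) :
    (MvPowerSeries.subst γ (witness k) : PowerSeries k) = 0 ∧
      ∀ m, (MvPowerSeries.subst γ (pd m (witness k)) : PowerSeries k) = 0 := by
  classical
  have has : MvPowerSeries.HasSubst γ := MvPowerSeries.hasSubst_of_constantCoeff_zero hγc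
  constructor
  · rw [witness, ← MvPowerSeries.coe_substAlgHom has]
    simp only [map_add, map_mul, map_pow, MvPowerSeries.substAlgHom_X]
    rcases h12 with h | h <;> simp [h0, h]
  · intro m
    rw [witness, map_add, pd_mul, pd_sq, pd_cube, pd_sq, ← MvPowerSeries.coe_substAlgHom has]
    simp only [map_add, map_mul, map_pow, map_ofNat, MvPowerSeries.substAlgHom_X]
    rcases h12 with h | h <;> simp [h0, h]

/-- `coordArc_apply_self` (see the module docstring). [folklore] -/
theorem coordArc_apply_self (a : Fin 3) : coordArc (k := k) a a = PowerSeries.X := by simp [coordArc]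
/-- `coordArc_apply_ne` (see the module docstring). [folklore] -/
theorem coordArc_apply_ne {a i : Fin 3} (h : i ≠ a) : coordArc (k := k) a i = 0 := by simp [coordArc, h]

/-- `witness_ne_zero` (see the module docstring). [folklore] -/
theorem witness_ne_zero : witness k ≠ 0 := by
  intro h
  have := congrArg (MvPowerSeries.coeff (Finsupp.single (0 : Fin 3) 2)) h
  rw [witness, map_add, MvPowerSeries.coeff_X_pow, if_pos rfl, map_zero] at this
  have h2 : MvPowerSeries.coeff (Finsupp.single (0 : Fin 3) 2)
      (MvPowerSeries.X 1 ^ 3 * MvPowerSeries.X 2 ^ 2 : MvPowerSeries (Fin 3) k) = 0 := by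
    apply MvPowerSeries.coeff_of_lt_order
    refine lt_of_lt_of_le ?_ MvPowerSeries.le_order_mul
    rw [Finsupp.degree_single]
    have h3 : (3 : ℕ∞) ≤ (MvPowerSeries.X (1 : Fin 3) ^ 3 : MvPowerSeries (Fin 3) k).order :=
      MvPowerSeries.le_order_pow_of_constantCoeff_eq_zero 3 (MvPowerSeries.constantCoeff_X (σ := Fin 3) (R := k) 1)
    have h2' : (2 : ℕ∞) ≤ (MvPowerSeries.X (2 : Fin 3) ^ 2 : MvPowerSeries (Fin 3) k).order :=
      MvPowerSeries.le_order_pow_of_constantCoeff_eq_zero 2 (MvPowerSeries.constantCoeff_X (σ := Fin 3) (R := k) 2)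
    calc ((2 : ℕ) : ℕ∞) < 3 + 2 := by norm_num
      _ ≤ _ := add_le_add h3 h2'
  rw [h2, add_zero] at this
  exact one_ne_zero this

/-- `two_le_order_witness` (see the module docstring). [folklore] -/
theorem two_le_order_witness : 2 ≤ (witness k).order := by
  rw [witness]
  refine le_trans ?_ MvPowerSeries.min_order_le_add
  refine le_min (MvPowerSeries.le_order_pow_of_constantCoeff_eq_zero 2 (MvPowerSeries.constantCoeff_X (σ := Fin 3) (R := k) 0)) ?_
  refine le_trans ?_ MvPowerSeries.le_order_mul
  calc (2 : ℕ∞) ≤ 3 + 2 := by norm_num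
    _ ≤ _ := add_le_add (MvPowerSeries.le_order_pow_of_constantCoeff_eq_zero 3 (MvPowerSeries.constantCoeff_X (σ := Fin 3) (R := k) 1))
        (MvPowerSeries.le_order_pow_of_constantCoeff_eq_zero 2 (MvPowerSeries.constantCoeff_X (σ := Fin 3) (R := k) 2))

/-- `order_witness` (see the module docstring). [folklore] -/
theorem order_witness : (witness k).order = 2 := by
  apply le_antisymm _ two_le_order_witness
  have := MvPowerSeries.order_le (f := witness k) (d := Finsupp.single (0 : Fin 3) 2) ?_
  · simpa using this
  · rw [witness, map_add, MvPowerSeries.coeff_X_pow, if_pos rfl]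
    have h2 : MvPowerSeries.coeff (Finsupp.single (0 : Fin 3) 2)
        (MvPowerSeries.X 1 ^ 3 * MvPowerSeries.X 2 ^ 2 : MvPowerSeries (Fin 3) k) = 0 := by
      apply MvPowerSeries.coeff_of_lt_order
      refine lt_of_lt_of_le ?_ MvPowerSeries.le_order_mul
      rw [Finsupp.degree_single]
      calc ((2 : ℕ) : ℕ∞) < 3 + 2 := by norm_num
        _ ≤ _ := add_le_add (MvPowerSeries.le_order_pow_of_constantCoeff_eq_zero 3 (MvPowerSeries.constantCoeff_X (σ := Fin 3) (R := k) 1))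
            (MvPowerSeries.le_order_pow_of_constantCoeff_eq_zero 2 (MvPowerSeries.constantCoeff_X (σ := Fin 3) (R := k) 2))
    rw [h2, add_zero]; exact one_ne_zero

/-- MAIN NEGATIVE THEOREM (game form, every field): from the witness `x² + y³z²` EVERY legal move
`(θ, w)` has an exceptional point off the vertex whose `s`-saturated successor is singular. [folklore] -/
theorem witness_has_singular_successor (k : Type) [Field k]
    (θ : Fin 3 → MvPowerSeries (Fin 3) k) (w : Fin 3 → ℕ)
    (hθ0 : ∀ i, MvPowerSeries.constantCoeff (θ i) = 0)
    (hdet : IsUnit (Matrix.det (Matrix.of fun i j => MvPowerSeries.coeff (Finsupp.single j 1) (θ i))))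
    (hw : ∃ i, 0 < w i) :
    ∃ (c : Fin 3 → k), (∃ i, 0 < w i ∧ c i ≠ 0) ∧ ∃ (a : ℕ) (g : MvPowerSeries (Fin 4) k),
      MvPowerSeries.subst (fun i : Fin 3 => if 0 < w i then
          MvPowerSeries.X (0 : Fin 4) ^ (w i) * (MvPowerSeries.C (c i) + MvPowerSeries.X i.succ)
          else MvPowerSeries.X i.succ) (MvPowerSeries.subst θ (witness k)) = MvPowerSeries.X 0 ^ a * g ∧
      ¬ MvPowerSeries.X 0 ∣ g ∧
      (MvPowerSeries.constantCoeff g = 0 ∧ ∀ j, MvPowerSeries.coeff (Finsupp.single j 1) g = 0) := by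
  classical
  set f' := MvPowerSeries.subst θ (witness k) with hf'
  have hf'0 : f' ≠ 0 := subst_ne_zero_of_isUnit_det hθ0 hdet witness_ne_zero
  have hf'2 : 2 ≤ f'.order := two_le_order_subst θ hθ0 _ two_le_order_witness
  -- the literal crux chart is `chart w c` once `c` follows the convention
  have hlit : ∀ c : Fin 3 → k, (∀ i, w i = 0 → c i = 0) →
      (fun i : Fin 3 => if 0 < w i then
          MvPowerSeries.X (0 : Fin 4) ^ (w i) * (MvPowerSeries.C (c i) + MvPowerSeries.X i.succ)
          else (MvPowerSeries.X i.succ : MvPowerSeries (Fin 4) k)) = chart w c := by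
    intro c hc
    rw [cruxChart_eq_chart]
    congr 1
    funext i
    split_ifs with h
    · rfl
    · exact (hc i (by omega)).symm
  by_cases hbig : ∃ j₀ : Fin 3, ∀ i, i ≠ j₀ → 0 < w i
  · -- |I| ≥ 2: the arc lemma
    obtain ⟨j₀, hI⟩ := hbig
    obtain ⟨ψ, hψ0, hcomp, -⟩ := exists_comp_inverse hθ0 hdet
    obtain ⟨a, ha12, i, hwi, hne⟩ := exists_coordArc_not_in_centre hψ0 hcomp w j₀ hI
    set γ := coordArc (k := k) a with hγ
    have hγc : ∀ i, PowerSeries.constantCoeff (γ i) = 0 := constantCoeff_coordArc a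
    set Γ : Fin 3 → PowerSeries k := fun i => MvPowerSeries.subst γ (ψ i) with hΓ
    have hΓc : ∀ i, PowerSeries.constantCoeff (Γ i) = 0 := constantCoeff_subst_arc_zero hψ0 γ hγc
    have hS : ∃ i, 0 < w i ∧ Γ i ≠ 0 := ⟨i, hwi, hne⟩
    have hγ0 : γ 0 = 0 := coordArc_apply_ne (by rcases ha12 with h | h <;> simp [h])
    have hγ12 : γ 1 = 0 ∨ γ 2 = 0 := by
      rcases ha12 with h | h
      · right; exact coordArc_apply_ne (by simp [h])
      · left; exact coordArc_apply_ne (by simp [h])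
    obtain ⟨hwγ, hwγpd⟩ := subst_arc_witness_eq_zero γ hγc hγ0 hγ12
    have hf : (MvPowerSeries.subst Γ f' : PowerSeries k) = 0 := by
      rw [hΓ, hf', subst_arc_comp hθ0 hψ0 hcomp γ hγc, hwγ]
    have hpd : ∀ m, (MvPowerSeries.subst Γ (pd m f') : PowerSeries k) = 0 := fun m => by
      rw [hΓ, hf']
      exact subst_arc_pd_comp hθ0 hψ0 hcomp γ hγc (witness k) hwγpd m
    obtain ⟨c, hc, hoff, hall⟩ := exists_offVertex_singular_of_arc w f' Γ hΓc hS hf hpd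
    have hF : MvPowerSeries.subst (chart w c) f' ≠ 0 := subst_chart_ne_zero w c hc hf'0
    obtain ⟨e, g, hfac, hg⟩ := CobordantVertexChart.exists_eq_X_pow_mul_not_dvd hF
    refine ⟨c, hoff, e, g, ?_, hg, hall e g hfac⟩
    rw [hlit c hc]
    exact hfac
  · -- |I| = 1: a divisorial move
    obtain ⟨i₀, hw₀⟩ := hw
    have hI : ∀ i, i ≠ i₀ → w i = 0 := by
      intro i hi
      by_contra hne
      apply hbig
      have key : ∀ i₀ i : Fin 3, i ≠ i₀ → ∃ j₀ : Fin 3, j₀ ≠ i₀ ∧ j₀ ≠ i ∧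
          ∀ l : Fin 3, l ≠ j₀ → l = i₀ ∨ l = i := by decide
      obtain ⟨j₀, -, -, hj⟩ := key i₀ i hi
      refine ⟨j₀, fun l hl => ?_⟩
      rcases hj l hl with rfl | rfl
      · exact hw₀
      · omega
    set c : Fin 3 → k := Pi.single i₀ 1 with hcdef
    have hc : ∀ i, w i = 0 → c i = 0 := by
      intro i hi
      have : i ≠ i₀ := fun h => by subst h; omega
      simp [hcdef, this]
    refine ⟨c, ⟨i₀, hw₀, by simp [hcdef]⟩, 0, MvPowerSeries.subst (chart w c) f', ?_, ?_, ?_⟩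
    · rw [hlit c hc, pow_zero, one_mul]
    · rw [hcdef, X_dvd_subst_chart_divisorial_iff w i₀ hw₀ hI]
      exact not_X_dvd_subst_witness hθ0 hdet i₀
    · exact (two_le_order_iff _).mp (two_le_order_subst (chart w c) (constantCoeff_chart w c hc) f' hf'2)

end Assembly


end Literature.AlgebraicGeometry.Resolution.CobordantArc
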